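import Mathlib
import Summits.MatrixMultiplication.MatrixMultiplication.Theses.ProbeRankThreshold

/-!
# Birth skeleton — crux `BoundedBlockExhaustion` (stmt-MatrixMultiplication-18287)

`BoundedBlockExhaustion` = "at some scale θ ≤ 1/2, bounded-block designs are asymptotically
optimal among all probe-rank-restricted decompositions of ⟨n,n,n⟩". Two genuine pieces, neither a
lower bound for a class containing the recursive designs (so neither implies `ScaleDeficit`):
* `stub_mechanismCompleteness` (COMPLETENESS OF THE TWO KNOWN MECHANISMS, at every scale
  `θ ≤ 1/2`): every decomposition at scale `θ` is matched — in the power-invariant exponents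
  (scale, cost) — EITHER by a bounded-block design (aggregation; `m ≤ b(θ)`, copies and rank-sums
  free) OR by a recursive design (a base algorithm for `⟨a,a,a⟩` with `R` terms Kroneckered with the
  schoolbook `⟨q,q,q⟩`: scale `log a / log(aq) ≤ θ`, cost exponent `3 log(R q³)/(3 log(aq))`);
* `stub_aggregationDominatesRecursion` (at SOME scale `θ ≤ 1/2`): every recursive design of scale
  `≤ θ` is matched by a bounded-block design of scale `≤ θ` (for the known designs this holds at
  small `θ` iff `ω(ℂ) > 2`: Pan's pair design with block `m(θ)` has slope `1 − log₂(1+3/m) → 1`,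
  recursion has slope `3 − ω_a`; under `ω = 2` it would need asymptotically flat bounded designs).
Composition `BoundedBlockExhaustion_of`: `θ, b₂` from the second stub, `b₁ := b(θ)` from the
first, `b := max b₁ b₂`, `ε/2 + ε/2`.
-/

namespace Summit.MatrixMultiplication.MatrixMultiplication.Cruxes.BoundedBlockExhaustion.Birth

open scoped BigOperators
open Literature.Computability.AlgebraicComplexity
open Summit.MatrixMultiplication.MatrixMultiplication.Theses.ProbeRankThreshold

/-- stub: COMPLETENESS OF MECHANISMS at every scale `θ ∈ (0,1/2]` — bounded-block aggregation
or recursion matches every probe-rank-restricted decomposition (classification-type claim; the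
deep part). -/
theorem stub_mechanismCompleteness :
    ∀ θ : ℝ, 0 < θ → θ ≤ 1 / 2 → ∃ b : ℕ, ∀ ε : ℝ, 0 < ε → ∃ n₁ : ℕ, ∀ n : ℕ, n₁ ≤ n →
      ∀ (r : ℕ) (w u v : Fin r → Fin n × Fin n → ℂ),
        matMulTensor ℂ n n n = ∑ i, triad (w i) (u i) (v i) →
        (∀ i, ((Matrix.of fun p q => w i (p, q)).rank : ℝ) ≤ (n : ℝ) ^ θ ∧
          ((Matrix.of fun p q => u i (p, q)).rank : ℝ) ≤ (n : ℝ) ^ θ ∧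
          ((Matrix.of fun p q => v i (p, q)).rank : ℝ) ≤ (n : ℝ) ^ θ) →
        ∀ σ : ℝ, (r : ℝ) ≤ (n : ℝ) ^ σ →
          (∃ (s m p r₀ : ℕ), 1 ≤ s ∧ 2 ≤ m ∧ m ≤ b ∧ 2 ≤ p ∧
            (p : ℝ) ^ 3 ≤ ((s * m ^ 3 : ℕ) : ℝ) ^ θ ∧
            (r₀ : ℝ) ^ 3 ≤ ((s * m ^ 3 : ℕ) : ℝ) ^ (σ + ε) ∧
            ∃ (w₀ u₀ v₀ : Fin r₀ → Fin s × (Fin m × Fin m) → ℂ),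
              kroneckerTensor (unitTensor ℂ s) (matMulTensor ℂ m m m) =
                ∑ i, triad (w₀ i) (u₀ i) (v₀ i) ∧
              ∀ i, ∑ c : Fin s, (Matrix.of fun p' q => w₀ i (c, (p', q))).rank ≤ p ∧
                ∑ c : Fin s, (Matrix.of fun p' q => u₀ i (c, (p', q))).rank ≤ p ∧
                ∑ c : Fin s, (Matrix.of fun p' q => v₀ i (c, (p', q))).rank ≤ p) ∨
          (∃ (a q R : ℕ), 2 ≤ a ∧ 1 ≤ q ∧
            (a : ℝ) ^ 3 ≤ (((a * q) ^ 3 : ℕ) : ℝ) ^ θ ∧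
            ((R * q ^ 3 : ℕ) : ℝ) ^ 3 ≤ (((a * q) ^ 3 : ℕ) : ℝ) ^ (σ + ε) ∧
            ∃ (w₁ u₁ v₁ : Fin R → Fin a × Fin a → ℂ),
              matMulTensor ℂ a a a = ∑ i, triad (w₁ i) (u₁ i) (v₁ i)) := by
  sorry

/-- stub: AGGREGATION DOMINATES RECURSION at some scale `θ ∈ (0,1/2]` with block bound `b`
(comparison of the two explicit mechanisms; true for the known designs at small `θ` iff
`ω(ℂ) > 2`). -/
theorem stub_aggregationDominatesRecursion :
    ∃ θ : ℝ, 0 < θ ∧ θ ≤ 1 / 2 ∧ ∃ b : ℕ, ∀ ε : ℝ, 0 < ε →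
      ∀ (a q R : ℕ), 2 ≤ a → 1 ≤ q → (a : ℝ) ^ 3 ≤ (((a * q) ^ 3 : ℕ) : ℝ) ^ θ →
      (∃ (w₁ u₁ v₁ : Fin R → Fin a × Fin a → ℂ),
          matMulTensor ℂ a a a = ∑ i, triad (w₁ i) (u₁ i) (v₁ i)) →
      ∀ τ : ℝ, ((R * q ^ 3 : ℕ) : ℝ) ^ 3 ≤ (((a * q) ^ 3 : ℕ) : ℝ) ^ τ →
          ∃ (s m p r₀ : ℕ), 1 ≤ s ∧ 2 ≤ m ∧ m ≤ b ∧ 2 ≤ p ∧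
            (p : ℝ) ^ 3 ≤ ((s * m ^ 3 : ℕ) : ℝ) ^ θ ∧
            (r₀ : ℝ) ^ 3 ≤ ((s * m ^ 3 : ℕ) : ℝ) ^ (τ + ε) ∧
            ∃ (w₀ u₀ v₀ : Fin r₀ → Fin s × (Fin m × Fin m) → ℂ),
              kroneckerTensor (unitTensor ℂ s) (matMulTensor ℂ m m m) =
                ∑ i, triad (w₀ i) (u₀ i) (v₀ i) ∧
              ∀ i, ∑ c : Fin s, (Matrix.of fun p' q => w₀ i (c, (p', q))).rank ≤ p ∧
                ∑ c : Fin s, (Matrix.of fun p' q => u₀ i (c, (p', q))).rank ≤ p ∧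
                ∑ c : Fin s, (Matrix.of fun p' q => v₀ i (c, (p', q))).rank ≤ p := by
  sorry

/-- Composition (sorry-free, explicit hypotheses = the two stub statements; conclusion = the
literal body of the route decl `BoundedBlockExhaustion`). -/
theorem BoundedBlockExhaustion_of_stubs
    (hC : ∀ θ : ℝ, 0 < θ → θ ≤ 1 / 2 → ∃ b : ℕ, ∀ ε : ℝ, 0 < ε → ∃ n₁ : ℕ, ∀ n : ℕ, n₁ ≤ n →
      ∀ (r : ℕ) (w u v : Fin r → Fin n × Fin n → ℂ),
        matMulTensor ℂ n n n = ∑ i, triad (w i) (u i) (v i) →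
        (∀ i, ((Matrix.of fun p q => w i (p, q)).rank : ℝ) ≤ (n : ℝ) ^ θ ∧
          ((Matrix.of fun p q => u i (p, q)).rank : ℝ) ≤ (n : ℝ) ^ θ ∧
          ((Matrix.of fun p q => v i (p, q)).rank : ℝ) ≤ (n : ℝ) ^ θ) →
        ∀ σ : ℝ, (r : ℝ) ≤ (n : ℝ) ^ σ →
          (∃ (s m p r₀ : ℕ), 1 ≤ s ∧ 2 ≤ m ∧ m ≤ b ∧ 2 ≤ p ∧
            (p : ℝ) ^ 3 ≤ ((s * m ^ 3 : ℕ) : ℝ) ^ θ ∧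
            (r₀ : ℝ) ^ 3 ≤ ((s * m ^ 3 : ℕ) : ℝ) ^ (σ + ε) ∧
            ∃ (w₀ u₀ v₀ : Fin r₀ → Fin s × (Fin m × Fin m) → ℂ),
              kroneckerTensor (unitTensor ℂ s) (matMulTensor ℂ m m m) =
                ∑ i, triad (w₀ i) (u₀ i) (v₀ i) ∧
              ∀ i, ∑ c : Fin s, (Matrix.of fun p' q => w₀ i (c, (p', q))).rank ≤ p ∧
                ∑ c : Fin s, (Matrix.of fun p' q => u₀ i (c, (p', q))).rank ≤ p ∧
                ∑ c : Fin s, (Matrix.of fun p' q => v₀ i (c, (p', q))).rank ≤ p) ∨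
          (∃ (a q R : ℕ), 2 ≤ a ∧ 1 ≤ q ∧
            (a : ℝ) ^ 3 ≤ (((a * q) ^ 3 : ℕ) : ℝ) ^ θ ∧
            ((R * q ^ 3 : ℕ) : ℝ) ^ 3 ≤ (((a * q) ^ 3 : ℕ) : ℝ) ^ (σ + ε) ∧
            ∃ (w₁ u₁ v₁ : Fin R → Fin a × Fin a → ℂ),
              matMulTensor ℂ a a a = ∑ i, triad (w₁ i) (u₁ i) (v₁ i)))
    (hD : ∃ θ : ℝ, 0 < θ ∧ θ ≤ 1 / 2 ∧ ∃ b : ℕ, ∀ ε : ℝ, 0 < ε →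
      ∀ (a q R : ℕ), 2 ≤ a → 1 ≤ q → (a : ℝ) ^ 3 ≤ (((a * q) ^ 3 : ℕ) : ℝ) ^ θ →
      (∃ (w₁ u₁ v₁ : Fin R → Fin a × Fin a → ℂ),
          matMulTensor ℂ a a a = ∑ i, triad (w₁ i) (u₁ i) (v₁ i)) →
      ∀ τ : ℝ, ((R * q ^ 3 : ℕ) : ℝ) ^ 3 ≤ (((a * q) ^ 3 : ℕ) : ℝ) ^ τ →
          ∃ (s m p r₀ : ℕ), 1 ≤ s ∧ 2 ≤ m ∧ m ≤ b ∧ 2 ≤ p ∧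
            (p : ℝ) ^ 3 ≤ ((s * m ^ 3 : ℕ) : ℝ) ^ θ ∧
            (r₀ : ℝ) ^ 3 ≤ ((s * m ^ 3 : ℕ) : ℝ) ^ (τ + ε) ∧
            ∃ (w₀ u₀ v₀ : Fin r₀ → Fin s × (Fin m × Fin m) → ℂ),
              kroneckerTensor (unitTensor ℂ s) (matMulTensor ℂ m m m) =
                ∑ i, triad (w₀ i) (u₀ i) (v₀ i) ∧
              ∀ i, ∑ c : Fin s, (Matrix.of fun p' q => w₀ i (c, (p', q))).rank ≤ p ∧
                ∑ c : Fin s, (Matrix.of fun p' q => u₀ i (c, (p', q))).rank ≤ p ∧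
                ∑ c : Fin s, (Matrix.of fun p' q => v₀ i (c, (p', q))).rank ≤ p) :
    (∃ θ : ℝ, 0 < θ ∧ θ ≤ 1 / 2 ∧ ∃ b : ℕ, ∀ ε : ℝ, 0 < ε → ∃ n₁ : ℕ, ∀ n : ℕ, n₁ ≤ n → ∀ (r : ℕ) (w u v : Fin r → Fin n × Fin n → ℂ), Literature.Computability.AlgebraicComplexity.matMulTensor ℂ n n n = ∑ i, Literature.Computability.AlgebraicComplexity.triad (w i) (u i) (v i) → (∀ i, ((Matrix.of fun p q => w i (p, q)).rank : ℝ) ≤ (n : ℝ) ^ θ ∧ ((Matrix.of fun p q => u i (p, q)).rank : ℝ) ≤ (n : ℝ) ^ θ ∧ ((Matrix.of fun p q => v i (p, q)).rank : ℝ) ≤ (n : ℝ) ^ θ) → ∀ σ : ℝ, (r : ℝ) ≤ (n : ℝ) ^ σ → ∃ (s m p r₀ : ℕ), 1 ≤ s ∧ 2 ≤ m ∧ m ≤ b ∧ 2 ≤ p ∧ (p : ℝ) ^ 3 ≤ ((s * m ^ 3 : ℕ) : ℝ) ^ θ ∧ (r₀ : ℝ) ^ 3 ≤ ((s * m ^ 3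 : ℕ) : ℝ) ^ (σ + ε) ∧ ∃ (w₀ u₀ v₀ : Fin r₀ → Fin s × (Fin m × Fin m) → ℂ), Literature.Computability.AlgebraicComplexity.kroneckerTensor (Literature.Computability.AlgebraicComplexity.unitTensor ℂ s) (Literature.Computability.AlgebraicComplexity.matMulTensor ℂ m m m) = ∑ i, Literature.Computability.AlgebraicComplexity.triad (w₀ i) (u₀ i) (v₀ i) ∧ ∀ i, ∑ c : Fin s, (Matrix.of fun p' q => w₀ i (c, (p', q))).rank ≤ p ∧ ∑ c : Fin s, (Matrix.of fun p' q => u₀ i (c, (p', q))).rank ≤ p ∧ ∑ c : Fin s, (Matrix.of fun p' q => v₀ i (c, (p', q))).rank ≤ p) := by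
  obtain ⟨θ, hθ, hθ2, b₂, hdom⟩ := hD
  obtain ⟨b₁, hcomp⟩ := hC θ hθ hθ2
  refine ⟨θ, hθ, hθ2, max b₁ b₂, ?_⟩
  intro ε hε
  have hε2 : 0 < ε / 2 := by linarith
  obtain ⟨n₁, hn₁⟩ := hcomp (ε / 2) hε2
  refine ⟨n₁, ?_⟩
  intro n hn r w u v hdec hprobe σ hr
  -- monotonicity of the cost bound in the exponent: `V ≥ 1`
  have hVmono : ∀ (s m r₀ : ℕ) (x y : ℝ), 1 ≤ s → 2 ≤ m → x ≤ y →
      (r₀ : ℝ) ^ 3 ≤ ((s * m ^ 3 : ℕ) : ℝ) ^ x → (r₀ : ℝ) ^ 3 ≤ ((s * m ^ 3 : ℕ) : ℝ) ^ y := by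
    intro s m r₀ x y hs hm hxy h
    have hV1 : (1 : ℝ) ≤ ((s * m ^ 3 : ℕ) : ℝ) := by
      have : 1 ≤ s * m ^ 3 := Nat.mul_le_mul hs (Nat.one_le_pow _ _ (by omega))
      exact_mod_cast this
    exact h.trans (Real.rpow_le_rpow_of_exponent_le hV1 hxy)
  rcases hn₁ n hn r w u v hdec hprobe σ hr with hB | hR
  · -- matched by a bounded-block design with `m ≤ b₁ ≤ max b₁ b₂`
    obtain ⟨s, m, p, r₀, hs, hm, hmb, hp, hsc, hco, w₀, u₀, v₀, hdec₀, hrk₀⟩ := hB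
    exact ⟨s, m, p, r₀, hs, hm, hmb.trans (le_max_left _ _), hp, hsc,
      hVmono s m r₀ (σ + ε / 2) (σ + ε) hs hm (by linarith) hco, w₀, u₀, v₀, hdec₀, hrk₀⟩
  · -- matched by a recursive design, which the second stub dominates by a bounded-block design
    obtain ⟨a, q, R, ha, hq, hsc, hco, hbase⟩ := hR
    obtain ⟨s, m, p, r₀, hs, hm, hmb, hp, hsc', hco', w₀, u₀, v₀, hdec₀, hrk₀⟩ :=
      hdom (ε / 2) hε2 a q R ha hq hsc hbase (σ + ε / 2) hco
    exact ⟨s, m, p, r₀, hs, hm, hmb.trans (le_max_right _ _), hp, hsc',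
      hVmono s m r₀ (σ + ε / 2 + ε / 2) (σ + ε) hs hm (by linarith) hco', w₀, u₀, v₀, hdec₀, hrk₀⟩

/-- THE skeleton theorem: the crux BY NAME from the two declared stubs (the only `sorry`s of the
file) through the sorry-free composition `BoundedBlockExhaustion_of_stubs`. [folklore] -/
theorem BoundedBlockExhaustion_of : BoundedBlockExhaustion :=
  BoundedBlockExhaustion_of_stubs stub_mechanismCompleteness stub_aggregationDominatesRecursion

end Summit.MatrixMultiplication.MatrixMultiplication.Cruxes.BoundedBlockExhaustion.Birth
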